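import Mathlib
import HarnessLib

/-!
# The interval-halving error estimate (Davis–Rabinowitz 1984, Sect. 4.9, (4.9.2)–(4.9.7))

Davis–Rabinowitz, *Methods of Numerical Integration* (2nd ed., 1984), Sect. 4.9 "Practical error estimation",
pp. 254–255 (after Fritsch, Kahaner and Lyness).  A basic rule `Q⁽¹⁾f = Q⁽¹⁾[a, a+h]f = If + c h^{m+3} f^{(m+2)}(ξ)`
(4.9.2); its two-panel compound `Q⁽²⁾f = Q⁽¹⁾[a, a+h/2]f + Q⁽¹⁾[a+h/2, a+h]f` (4.9.3); the error estimate
`Ef = (Q⁽¹⁾f - Q⁽²⁾f)/(2^{m+2} - 1)` (4.9.4) and the extrapolated value `Q⁽¹'²⁾f = Q⁽²⁾f - Ef` (4.9.5); then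
`Q⁽²⁾f = If + c h^{m+3} f^{(m+2)}(ξ₁)/2^{m+2}` (4.9.6) and `Q⁽¹⁾f - Q⁽²⁾f = (1 - 2^{m+2}) c h^{m+3} f^{(m+2)}(ξ₂)` (4.9.7).

Recorded: (i) the algebra on the model where the derivative factor is one constant `K` (then `Ef` is exactly the
error of `Q⁽²⁾` and `Q⁽¹'²⁾f = If`); (ii) the Simpson instance (`m = 2`, `2^{m+2} - 1 = 15`, the "divide the
difference by fifteen" rule), stated for any rule functional `Q` satisfying `IsSimpsonRule Q` (so it applies verbatim to
the tree's `Literature.Analysis.Quadrature.simpson`, which is not re-defined here): on quartic polynomials (where `f⁽⁴⁾` is constant, so the model is exact) `Ef` equals the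
error of the compound Simpson value exactly, and `Q⁽¹'²⁾ = (16 Q⁽²⁾ - Q⁽¹⁾)/15` integrates every polynomial of degree
`≤ 5` exactly (it is the closed five-point Newton–Cotes (Boole) rule), with defect `-(b-a)⁷·c₆/2688` pinned on sextics.

Provenance: engines group, shared numerical engines serving client cells; rigour lives in the verifiers; every
published number belongs to a client cell's ledger, not to the engines group.  Textbook facts only (no client
numbers).
-/

namespace Literature.Analysis.Quadrature

open Finset Polynomial intervalIntegral

noncomputable section

/-! ### (i) the model algebra (4.9.2)–(4.9.7) with a constant derivative factor -/

section Model

variable {K : Type*} [Field K]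

/-- (4.9.4): `Ef = (Q⁽¹⁾f - Q⁽²⁾f)/(2^{m+2} - 1)`. [cite: DavisRabinowitz1984, Sect. 4.9 (4.9.4)] -/
def halvingEstimate (m : ℕ) (Q₁ Q₂ : K) : K := (Q₁ - Q₂) / (2 ^ (m + 2) - 1)

/-- (4.9.5): `Q⁽¹'²⁾f = Q⁽²⁾f - Ef`. [cite: DavisRabinowitz1984, Sect. 4.9 (4.9.5)] -/
def halvingExtrapolation (m : ℕ) (Q₁ Q₂ : K) : K := Q₂ - halvingEstimate m Q₁ Q₂

/-- On the model `Q⁽¹⁾ = I + c h^{m+3} K`, `Q⁽²⁾ = I + c h^{m+3} K / 2^{m+2}` ((4.9.2), (4.9.6) with one constant `K` in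
place of `f^{(m+2)}(ξ)`, `f^{(m+2)}(ξ₁)`): `Q⁽¹⁾ - Q⁽²⁾ = (1 - 2^{m+2}) c h^{m+3} K / 2^{m+2}`, i.e. (4.9.7) with the
factor of (4.9.6), and the estimate `E` is exactly the error of `Q⁽²⁾` (needs `2^{m+2} ≠ 1` in `K`).
[cite: DavisRabinowitz1984, Sect. 4.9 (4.9.6)-(4.9.7)] -/
theorem halvingEstimate_model [CharZero K] (m : ℕ) (I c h κ : K) :
    halvingEstimate m (I + c * h ^ (m + 3) * κ) (I + c * h ^ (m + 3) * κ / 2 ^ (m + 2))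
      = c * h ^ (m + 3) * κ / 2 ^ (m + 2) := by
  have h2 : (2 : K) ^ (m + 2) - 1 ≠ 0 := by
    rw [sub_ne_zero]
    norm_cast
    exact (Nat.one_lt_pow (by omega) (by norm_num)).ne'
  have h2' : (2 : K) ^ (m + 2) ≠ 0 := pow_ne_zero _ two_ne_zero
  rw [halvingEstimate, div_eq_iff h2]
  field_simp
  ring

/-- Hence on the model the extrapolated value (4.9.5) is the integral itself.
[cite: DavisRabinowitz1984, Sect. 4.9 (4.9.5)] -/
theorem halvingExtrapolation_model [CharZero K] (m : ℕ) (I c h κ : K) :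
    halvingExtrapolation m (I + c * h ^ (m + 3) * κ) (I + c * h ^ (m + 3) * κ / 2 ^ (m + 2)) = I := by
  rw [halvingExtrapolation, halvingEstimate_model]
  ring

end Model

/-! ### (ii) the Simpson instance: `m = 2`, divide the difference by `15` -/

/-- [folklore] `∫_a^b p = Σ_{i<n} c_i (b^{i+1} - a^{i+1})/(i+1)` for `deg p < n`. -/
private theorem integral_eval_eq_sum₄₉ (p : ℝ[X]) {n : ℕ} (hn : p.natDegree < n) (a b : ℝ) :
    ∫ x in a..b, p.eval x = ∑ i ∈ range n, p.coeff i * ((b ^ (i + 1) - a ^ (i + 1)) / (i + 1)) := by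
  simp_rw [eval_eq_sum_range' hn]
  rw [intervalIntegral.integral_finsetSum fun i _ => ?_]
  · refine Finset.sum_congr rfl fun i _ => ?_
    rw [intervalIntegral.integral_const_mul, integral_pow]
  · exact (continuous_const.mul (continuous_pow i)).intervalIntegrable _ _

/-- (4.9.3): the two-panel compound of a basic rule `Q`, `Q⁽²⁾[a, b]f = Q[a, (a+b)/2]f + Q[(a+b)/2, b]f`.
[cite: DavisRabinowitz1984, Sect. 4.9 (4.9.3)] -/
def twoPanel (Q : (ℝ → ℝ) → ℝ → ℝ → ℝ) (f : ℝ → ℝ) (a b : ℝ) : ℝ :=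
  Q f a ((a + b) / 2) + Q f ((a + b) / 2) b

/-- "`Q` is Simpson's rule": `Q[a, b]f = (b-a)/6 [f(a) + 4f((a+b)/2) + f(b)]` (the basic rule with `m = 2`, `h = b - a`;
stated as a hypothesis so that the results apply verbatim to the tree's `Literature.Analysis.Quadrature.simpson`).
[cite: DavisRabinowitz1984, Sect. 4.9 (4.9.2)] -/
def IsSimpsonRule (Q : (ℝ → ℝ) → ℝ → ℝ → ℝ) : Prop :=
  ∀ f a b, Q f a b = (b - a) / 6 * (f a + 4 * f ((a + b) / 2) + f b)

section Simpson

variable {Q : (ℝ → ℝ) → ℝ → ℝ → ℝ} (hQ : IsSimpsonRule Q)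
include hQ

/-- (4.9.2) for Simpson on quartics: `Q⁽¹⁾p - Ip = (b-a)⁵/2880 · (24 c₄)` exactly (`c h^{m+3} f^{(m+2)}` with
`m = 2`, `h = b - a`, `c = 1/2880`, `p⁽⁴⁾ ≡ 24c₄`). [cite: DavisRabinowitz1984, Sect. 4.9 (4.9.2)] -/
theorem simpson_sub_integral_of_natDegree_le_four (p : ℝ[X]) (hp : p.natDegree ≤ 4) (a b : ℝ) :
    Q (fun x => p.eval x) a b - ∫ x in a..b, p.eval x = (b - a) ^ 5 / 2880 * (24 * p.coeff 4) := by
  have hn : p.natDegree < 5 := by omega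
  rw [integral_eval_eq_sum₄₉ p hn, hQ]
  simp only [eval_eq_sum_range' hn, Finset.sum_range_succ, Finset.sum_range_zero]
  push_cast
  ring

/-- (4.9.6) for Simpson on quartics: the compound value errs by the same quantity divided by `2^{m+2} = 16`.
[cite: DavisRabinowitz1984, Sect. 4.9 (4.9.6)] -/
theorem twoPanel_simpson_sub_integral_of_natDegree_le_four (p : ℝ[X]) (hp : p.natDegree ≤ 4) (a b : ℝ) :
    twoPanel Q (fun x => p.eval x) a b - ∫ x in a..b, p.eval x = (b - a) ^ 5 / 2880 * (24 * p.coeff 4) / 16 := by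
  have hn : p.natDegree < 5 := by omega
  rw [integral_eval_eq_sum₄₉ p hn, twoPanel, hQ, hQ]
  simp only [eval_eq_sum_range' hn, Finset.sum_range_succ, Finset.sum_range_zero]
  push_cast
  ring

/-- (4.9.4)/(4.9.7) for Simpson on quartics: `Ef = (Q⁽¹⁾ - Q⁽²⁾)/15` is exactly the error of the compound value.
[cite: DavisRabinowitz1984, Sect. 4.9 (4.9.4), (4.9.7)] -/
theorem halvingEstimate_simpson_of_natDegree_le_four (p : ℝ[X]) (hp : p.natDegree ≤ 4) (a b : ℝ) :
    halvingEstimate 2 (Q (fun x => p.eval x) a b) (twoPanel Q (fun x => p.eval x) a b)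
      = twoPanel Q (fun x => p.eval x) a b - ∫ x in a..b, p.eval x := by
  have h1 := simpson_sub_integral_of_natDegree_le_four hQ p hp a b
  have h2 := twoPanel_simpson_sub_integral_of_natDegree_le_four hQ p hp a b
  rw [halvingEstimate]
  norm_num
  linarith

/-- (4.9.5) for Simpson is the closed five-point (Boole) rule: `(16Q⁽²⁾ - Q⁽¹⁾)/15 =
(b-a)/90 [7f(a) + 32f(a+h) + 12f(a+2h) + 32f(a+3h) + 7f(b)]`, `h = (b-a)/4`, for every `f` (the right-hand side is
the tree's `Literature.Analysis.Quadrature.booleRule f a b`, written out). [cite: DavisRabinowitz1984, Sect. 4.9 (4.9.5)] -/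
theorem halvingExtrapolation_simpson_eq_boole (f : ℝ → ℝ) (a b : ℝ) :
    halvingExtrapolation 2 (Q f a b) (twoPanel Q f a b)
      = (b - a) / 90 * (7 * f a + 32 * f (a + (b - a) / 4) + 12 * f (a + (b - a) / 2)
          + 32 * f (a + 3 * (b - a) / 4) + 7 * f b) := by
  rw [halvingExtrapolation, halvingEstimate, twoPanel, hQ, hQ, hQ]
  have e1 : (a + (a + b) / 2) / 2 = a + (b - a) / 4 := by ring
  have e2 : (a + b) / 2 = a + (b - a) / 2 := by ring
  have e3 : ((a + b) / 2 + b) / 2 = a + 3 * (b - a) / 4 := by ring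
  rw [e1, e3, e2]
  norm_num
  ring

/-- Hence the extrapolated value integrates every polynomial of degree `≤ 5` exactly (one degree more than the model
promises). [cite: DavisRabinowitz1984, Sect. 4.9 (4.9.5)] -/
theorem halvingExtrapolation_simpson_of_natDegree_le_five (p : ℝ[X]) (hp : p.natDegree ≤ 5) (a b : ℝ) :
    halvingExtrapolation 2 (Q (fun x => p.eval x) a b) (twoPanel Q (fun x => p.eval x) a b)
      = ∫ x in a..b, p.eval x := by
  have hn : p.natDegree < 6 := by omega
  rw [halvingExtrapolation_simpson_eq_boole hQ, integral_eval_eq_sum₄₉ p hn]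
  simp only [eval_eq_sum_range' hn, Finset.sum_range_succ, Finset.sum_range_zero]
  push_cast
  ring

/-- … and on sextics its defect is `-(b-a)⁷ c₆/2688` (the Boole-rule error `-(8/945) h⁷ f⁽⁶⁾` with `h = (b-a)/4`,
`f⁽⁶⁾ ≡ 720c₆`). [cite: DavisRabinowitz1984, Sect. 4.9 (4.9.5)] -/
theorem integral_sub_halvingExtrapolation_simpson_of_natDegree_le_six (p : ℝ[X]) (hp : p.natDegree ≤ 6) (a b : ℝ) :
    (∫ x in a..b, p.eval x) - halvingExtrapolation 2 (Q (fun x => p.eval x) a b) (twoPanel Q (fun x => p.eval x) a b)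
      = -((b - a) ^ 7 * p.coeff 6 / 2688) := by
  have hn : p.natDegree < 7 := by omega
  rw [halvingExtrapolation_simpson_eq_boole hQ, integral_eval_eq_sum₄₉ p hn]
  simp only [eval_eq_sum_range' hn, Finset.sum_range_succ, Finset.sum_range_zero]
  push_cast
  ring

end Simpson

end

end Literature.Analysis.Quadrature
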